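import Mathlib
import Summits.MatrixMultiplication.MatrixMultiplication.Theorems.SubgroupIdentityDesigns.Negative.LevelOneFloor
import Summits.MatrixMultiplication.MatrixMultiplication.Theorems.SubgroupIdentityDesigns.Negative.StandardLines
import Summits.MatrixMultiplication.MatrixMultiplication.Theorems.SubgroupIdentityDesigns.Negative.SingerWitness
import Summits.MatrixMultiplication.MatrixMultiplication.Theorems.SubgroupIdentityDesigns.Negative.RegularSL
import Summits.MatrixMultiplication.MatrixMultiplication.Theorems.SubgroupIdentityDesigns.Negative.RegularCentral

/-!
# Level-one witnesses avoid the exceptional regular groups (witness form, all three members)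

Route `LevelGradedCohnUmans`, crux `SubgroupIdentityDesigns`, the `(m,k) = (2,1)` cell.  Witness
forms of `RegularSL` and `RegularCentral`: a level-one WITNESS (TPP + level-`1` identity design +
the crux inequality, `-2 < ε ≤ 1`, `p ≥ 3`) has pairwise disjoint members of order `≥ p + 1`
(`levelOne_witness_window`, `subgroupTPP_disjoint`), so a regular subgroup `K` of one member
always finds an element of another member outside `K`.  Hence NO MEMBER OF A LEVEL-ONE WITNESS
CONTAINS a subgroup of `SL₂(𝔽_p)` of order `p² - 1` (`no_levelOne_witness_of_unimodular_member₁/₂/₃`;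
`2T < GL₂(𝔽₅)`, `2O < GL₂(𝔽₇)`, `2I < GL₂(𝔽₁₁)`) or a central product `μ_M · K₁` of order
`p² - 1` as in `RegularCentral` (`no_levelOne_witness_of_central_unimodular_member₁/₂/₃`;
`2T ∘ μ₅ < GL₂(𝔽₁₁)` and the near-field groups of orders `23², 29², 59²`).  The hypotheses are
conjugation-invariant, so no separate conjugate forms are needed.
VALUE = THEOREM, NOT summit progress; the crux item stmt-MatrixMultiplication-14079 is untouched
and remains open.
-/

set_option linter.dupNamespace false

noncomputable section

open scoped BigOperators Classical

open Summit.MatrixMultiplication.MatrixMultiplication.Theorems.LieRankDesigns.Negative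
  (GLm Mat budget)

open Literature.Barriers.MatrixMultiplication (SubgroupTPP)

namespace Summit.MatrixMultiplication.MatrixMultiplication.Theorems.SubgroupIdentityDesigns.Negative

section RegularWitness

variable {p : ℕ} [hp : Fact p.Prime]

/-- **No member `H₁` of a level-one witness contains a subgroup of `SL₂(𝔽_p)` of order `p² - 1`.** -/
theorem no_levelOne_witness_of_unimodular_member₁ (hp3 : 3 ≤ p) {ε : ℝ} (hε : -2 < ε) (hε1 : ε ≤ 1)
    {H₁ H₂ H₃ : Subgroup (GLm p 2)} (htpp : SubgroupTPP H₁ H₂ H₃)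
    (hdesign : ∃ c : Mat p 2 → ℂ, (∀ M, 1 < M.rank → c M = 0) ∧
      (∑ M, c M * ZMod.stdAddChar (Matrix.trace (M * ((1 : GLm p 2) : Mat p 2)))) = 1 ∧
      ∀ a ∈ H₁, ∀ b ∈ H₂, ∀ g ∈ H₃, a * b * g ≠ 1 →
        (∑ M, c M *
          ZMod.stdAddChar (Matrix.trace (M * ((a * b * g : GLm p 2) : Mat p 2)))) = 0)
    (hwit : budget p 2 1 (2 + ε) <
      ((Nat.card H₁ * Nat.card H₂ * Nat.card H₃ : ℕ) : ℝ) ^ ((2 + ε) / 3))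
    (K : Subgroup (GLm p 2)) (hKdet : ∀ k ∈ K, Matrix.det ((k : GLm p 2) : Mat p 2) = 1)
    (hKcard : Nat.card K = p ^ 2 - 1) (hKH : K ≤ H₁) : False := by
  obtain ⟨-, ⟨hlo, -⟩, -⟩ := levelOne_witness_window hp3 hε hε1 htpp hdesign hwit
  obtain ⟨h, hh, hh1⟩ := exists_ne_one_of_card_ge hlo
  refine no_levelOne_design_of_unimodular₁₂ K hKdet hKcard hKH h hh (fun hk => hh1 ?_) hdesign
  exact Subgroup.disjoint_def.mp (StandardLines.subgroupTPP_disjoint htpp).1 (hKH hk) hh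

/-- **No member `H₂` of a level-one witness contains a subgroup of `SL₂(𝔽_p)` of order `p² - 1`.** -/
theorem no_levelOne_witness_of_unimodular_member₂ (hp3 : 3 ≤ p) {ε : ℝ} (hε : -2 < ε) (hε1 : ε ≤ 1)
    {H₁ H₂ H₃ : Subgroup (GLm p 2)} (htpp : SubgroupTPP H₁ H₂ H₃)
    (hdesign : ∃ c : Mat p 2 → ℂ, (∀ M, 1 < M.rank → c M = 0) ∧
      (∑ M, c M * ZMod.stdAddChar (Matrix.trace (M * ((1 : GLm p 2) : Mat p 2)))) = 1 ∧
      ∀ a ∈ H₁, ∀ b ∈ H₂, ∀ g ∈ H₃, a * b * g ≠ 1 →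
        (∑ M, c M *
          ZMod.stdAddChar (Matrix.trace (M * ((a * b * g : GLm p 2) : Mat p 2)))) = 0)
    (hwit : budget p 2 1 (2 + ε) <
      ((Nat.card H₁ * Nat.card H₂ * Nat.card H₃ : ℕ) : ℝ) ^ ((2 + ε) / 3))
    (K : Subgroup (GLm p 2)) (hKdet : ∀ k ∈ K, Matrix.det ((k : GLm p 2) : Mat p 2) = 1)
    (hKcard : Nat.card K = p ^ 2 - 1) (hKH : K ≤ H₂) : False := by
  obtain ⟨⟨hlo, -⟩, -, -⟩ := levelOne_witness_window hp3 hε hε1 htpp hdesign hwit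
  obtain ⟨h, hh, hh1⟩ := exists_ne_one_of_card_ge hlo
  refine no_levelOne_design_of_unimodular₂₁ K hKdet hKcard hKH h hh (fun hk => hh1 ?_) hdesign
  exact Subgroup.disjoint_def.mp (StandardLines.subgroupTPP_disjoint htpp).1 hh (hKH hk)

/-- **No member `H₃` of a level-one witness contains a subgroup of `SL₂(𝔽_p)` of order `p² - 1`.** -/
theorem no_levelOne_witness_of_unimodular_member₃ (hp3 : 3 ≤ p) {ε : ℝ} (hε : -2 < ε) (hε1 : ε ≤ 1)
    {H₁ H₂ H₃ : Subgroup (GLm p 2)} (htpp : SubgroupTPP H₁ H₂ H₃)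
    (hdesign : ∃ c : Mat p 2 → ℂ, (∀ M, 1 < M.rank → c M = 0) ∧
      (∑ M, c M * ZMod.stdAddChar (Matrix.trace (M * ((1 : GLm p 2) : Mat p 2)))) = 1 ∧
      ∀ a ∈ H₁, ∀ b ∈ H₂, ∀ g ∈ H₃, a * b * g ≠ 1 →
        (∑ M, c M *
          ZMod.stdAddChar (Matrix.trace (M * ((a * b * g : GLm p 2) : Mat p 2)))) = 0)
    (hwit : budget p 2 1 (2 + ε) <
      ((Nat.card H₁ * Nat.card H₂ * Nat.card H₃ : ℕ) : ℝ) ^ ((2 + ε) / 3))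
    (K : Subgroup (GLm p 2)) (hKdet : ∀ k ∈ K, Matrix.det ((k : GLm p 2) : Mat p 2) = 1)
    (hKcard : Nat.card K = p ^ 2 - 1) (hKH : K ≤ H₃) : False := by
  obtain ⟨⟨hlo, -⟩, -, -⟩ := levelOne_witness_window hp3 hε hε1 htpp hdesign hwit
  obtain ⟨h, hh, hh1⟩ := exists_ne_one_of_card_ge hlo
  refine no_levelOne_design_of_unimodular₃₁ K hKdet hKcard hKH h hh (fun hk => hh1 ?_) hdesign
  exact Subgroup.disjoint_def.mp (StandardLines.subgroupTPP_disjoint htpp).2.1 hh (hKH hk)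

/-- **No member `H₁` of a level-one witness contains a central product `μ_M · K₁` (`K₁` unimodular
of exponent `∣ N`, `gcd(M,N) = 1`, `p ∤ N`) of order `p² - 1`.** -/
theorem no_levelOne_witness_of_central_unimodular_member₁ (hp3 : 3 ≤ p) {ε : ℝ} (hε : -2 < ε)
    (hε1 : ε ≤ 1)
    {H₁ H₂ H₃ : Subgroup (GLm p 2)} (htpp : SubgroupTPP H₁ H₂ H₃)
    (hdesign : ∃ c : Mat p 2 → ℂ, (∀ M, 1 < M.rank → c M = 0) ∧
      (∑ M, c M * ZMod.stdAddChar (Matrix.trace (M * ((1 : GLm p 2) : Mat p 2)))) = 1 ∧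
      ∀ a ∈ H₁, ∀ b ∈ H₂, ∀ g ∈ H₃, a * b * g ≠ 1 →
        (∑ M, c M *
          ZMod.stdAddChar (Matrix.trace (M * ((a * b * g : GLm p 2) : Mat p 2)))) = 0)
    (hwit : budget p 2 1 (2 + ε) <
      ((Nat.card H₁ * Nat.card H₂ * Nat.card H₃ : ℕ) : ℝ) ^ ((2 + ε) / 3))
    (K : Subgroup (GLm p 2)) {M N : ℕ} (hN : ¬ p ∣ N) (hMN : Nat.Coprime M N)
    (hK : ∀ k ∈ K, ∃ s : ZMod p, ∃ g : GLm p 2, s ^ M = 1 ∧ Matrix.det (g : Mat p 2) = 1 ∧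
      g ^ N = 1 ∧ ((k : GLm p 2) : Mat p 2) = s • (g : Mat p 2))
    (hKcard : Nat.card K = p ^ 2 - 1) (hKH : K ≤ H₁) : False := by
  obtain ⟨-, ⟨hlo, -⟩, -⟩ := levelOne_witness_window hp3 hε hε1 htpp hdesign hwit
  obtain ⟨h, hh, hh1⟩ := exists_ne_one_of_card_ge hlo
  refine no_levelOne_design_of_central_unimodular₁₂ K hN hMN hK hKcard hKH h hh
    (fun hk => hh1 ?_) hdesign
  exact Subgroup.disjoint_def.mp (StandardLines.subgroupTPP_disjoint htpp).1 (hKH hk) hh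

/-- **No member `H₂` of a level-one witness contains a central product `μ_M · K₁` (`K₁` unimodular
of exponent `∣ N`, `gcd(M,N) = 1`, `p ∤ N`) of order `p² - 1`.** -/
theorem no_levelOne_witness_of_central_unimodular_member₂ (hp3 : 3 ≤ p) {ε : ℝ} (hε : -2 < ε)
    (hε1 : ε ≤ 1)
    {H₁ H₂ H₃ : Subgroup (GLm p 2)} (htpp : SubgroupTPP H₁ H₂ H₃)
    (hdesign : ∃ c : Mat p 2 → ℂ, (∀ M, 1 < M.rank → c M = 0) ∧
      (∑ M, c M * ZMod.stdAddChar (Matrix.trace (M * ((1 : GLm p 2) : Mat p 2)))) = 1 ∧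
      ∀ a ∈ H₁, ∀ b ∈ H₂, ∀ g ∈ H₃, a * b * g ≠ 1 →
        (∑ M, c M *
          ZMod.stdAddChar (Matrix.trace (M * ((a * b * g : GLm p 2) : Mat p 2)))) = 0)
    (hwit : budget p 2 1 (2 + ε) <
      ((Nat.card H₁ * Nat.card H₂ * Nat.card H₃ : ℕ) : ℝ) ^ ((2 + ε) / 3))
    (K : Subgroup (GLm p 2)) {M N : ℕ} (hN : ¬ p ∣ N) (hMN : Nat.Coprime M N)
    (hK : ∀ k ∈ K, ∃ s : ZMod p, ∃ g : GLm p 2, s ^ M = 1 ∧ Matrix.det (g : Mat p 2) = 1 ∧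
      g ^ N = 1 ∧ ((k : GLm p 2) : Mat p 2) = s • (g : Mat p 2))
    (hKcard : Nat.card K = p ^ 2 - 1) (hKH : K ≤ H₂) : False := by
  obtain ⟨⟨hlo, -⟩, -, -⟩ := levelOne_witness_window hp3 hε hε1 htpp hdesign hwit
  obtain ⟨h, hh, hh1⟩ := exists_ne_one_of_card_ge hlo
  refine no_levelOne_design_of_central_unimodular₂₁ K hN hMN hK hKcard hKH h hh
    (fun hk => hh1 ?_) hdesign
  exact Subgroup.disjoint_def.mp (StandardLines.subgroupTPP_disjoint htpp).1 hh (hKH hk)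

/-- **No member `H₃` of a level-one witness contains a central product `μ_M · K₁` (`K₁` unimodular
of exponent `∣ N`, `gcd(M,N) = 1`, `p ∤ N`) of order `p² - 1`.** -/
theorem no_levelOne_witness_of_central_unimodular_member₃ (hp3 : 3 ≤ p) {ε : ℝ} (hε : -2 < ε)
    (hε1 : ε ≤ 1)
    {H₁ H₂ H₃ : Subgroup (GLm p 2)} (htpp : SubgroupTPP H₁ H₂ H₃)
    (hdesign : ∃ c : Mat p 2 → ℂ, (∀ M, 1 < M.rank → c M = 0) ∧
      (∑ M, c M * ZMod.stdAddChar (Matrix.trace (M * ((1 : GLm p 2) : Mat p 2)))) = 1 ∧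
      ∀ a ∈ H₁, ∀ b ∈ H₂, ∀ g ∈ H₃, a * b * g ≠ 1 →
        (∑ M, c M *
          ZMod.stdAddChar (Matrix.trace (M * ((a * b * g : GLm p 2) : Mat p 2)))) = 0)
    (hwit : budget p 2 1 (2 + ε) <
      ((Nat.card H₁ * Nat.card H₂ * Nat.card H₃ : ℕ) : ℝ) ^ ((2 + ε) / 3))
    (K : Subgroup (GLm p 2)) {M N : ℕ} (hN : ¬ p ∣ N) (hMN : Nat.Coprime M N)
    (hK : ∀ k ∈ K, ∃ s : ZMod p, ∃ g : GLm p 2, s ^ M = 1 ∧ Matrix.det (g : Mat p 2) = 1 ∧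
      g ^ N = 1 ∧ ((k : GLm p 2) : Mat p 2) = s • (g : Mat p 2))
    (hKcard : Nat.card K = p ^ 2 - 1) (hKH : K ≤ H₃) : False := by
  obtain ⟨⟨hlo, -⟩, -, -⟩ := levelOne_witness_window hp3 hε hε1 htpp hdesign hwit
  obtain ⟨h, hh, hh1⟩ := exists_ne_one_of_card_ge hlo
  refine no_levelOne_design_of_central_unimodular₃₁ K hN hMN hK hKcard hKH h hh
    (fun hk => hh1 ?_) hdesign
  exact Subgroup.disjoint_def.mp (StandardLines.subgroupTPP_disjoint htpp).2.1 hh (hKH hk)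

end RegularWitness

end Summit.MatrixMultiplication.MatrixMultiplication.Theorems.SubgroupIdentityDesigns.Negative

end
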